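import Mathlib
import Summits.AtomisticToContinuum.HydrodynamicLimit.Theorems.ImplosionDichotomyDenseExcursionPackingAnalyticDefsB

/-!
# `C¹` recovery off the sonic point, POINTWISE: the first-order system solved for the derivatives
# (crux `DenseExcursion`, stmt-AtomisticToContinuum-12586, line `sonic-cavity-renewal` v7, stub `stub_analyticPackingImplosion`)

Helper file (`--supports stmt-AtomisticToContinuum-12586`, line lead a2, wave-3 worker D, task `derivRecovery_offSonic`,
algebraic core). The resolvent equation `Λu − Lu = f`, `L = (linW, linS)` of `…R2Modes`, is a FIRST-ORDER system: in the
unknowns `u₁′` and `v′ = (u₂/S)′` (`v = u₂/S` the relative sound-speed perturbation — the weight of `PackingResolvent`) it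
reads
  `(W − 1) u₁′ + 3S² v′ = R₁ := Λu₁ − (W′ + 2W − r)u₁ − 6S(S′ + S) v − f₁`,
  `(1/3) u₁′ + (W − 1) v′ = R₂ := Λv − (S′/S + 2)u₁ − (W′/3 + 2W − r + (W − 1)S′/S) v − f₂/S`,
with determinant `Δ = (W − 1)² − S²` (zero exactly at the sonic point). Kernel-checked here:

* `derivRecovery_pointwise` (REGISTERED helper): at a point where `|W|, |W′|, |S′/S|, |S(S′+S)| ≤ A` and
  `1 + S² ≤ K|Δ|`, every solution satisfies
  `|u₁′| + (1 + S²)|(u₂/S)′| ≤ (2A + 6) K (A² + 10A + r + 3) · ((|Λ| + 1)(|u₁| + |u₂|/S) + |f₁| + |f₂|/S)`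
  — NO LOSS: one `x`-derivative costs one power of `Λ` in the weighted `C⁰` norm, with the weight `S²` on `(u₂/S)′`
  exactly compensating `Δ ≈ −S²` at the centre (`adj B/Δ`), and `S(S′ + S)` (bounded at the centre) the only profile
  combination multiplying `v` in `R₁`.

Pure real algebra (Cramer's rule for the `2 × 2` system + triangle inequalities). NOT here: the profile envelope
(`A`, `K` from `CavityTube` on `x ≤ 1` and from the far-field limits on `x ≥ 1`; companion files), norms, or `Γ`.
-/

noncomputable section

namespace Summit.AtomisticToContinuum.HydrodynamicLimit.Theorems.PackingAnalyticImplosion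

/-! ## Small absolute-value tools -/

/-- `|c z| ≤ a |z|` from `|c| ≤ a`. [folklore] -/
theorem abs_mul_le_of_abs_le {c a : ℝ} (h : |c| ≤ a) (z : ℝ) : |c * z| ≤ a * |z| := by
  rw [abs_mul]; exact mul_le_mul_of_nonneg_right h (abs_nonneg z)

/-- A product is between `∓` the bound of its absolute value. [folklore] -/
theorem mul_mem_bounds {c a : ℝ} (h : |c| ≤ a) (z : ℝ) : -(a * |z|) ≤ c * z ∧ c * z ≤ a * |z| := by
  have h1 := abs_mul_le_of_abs_le h z
  exact ⟨by linarith [neg_abs_le (c * z)], (le_abs_self _).trans h1⟩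

/-! ## The pointwise recovery -/

set_option maxHeartbeats 800000 in -- one declaration: many `linarith`/`field_simp` steps in one pointwise estimate
/-- **`C¹` RECOVERY OFF THE SONIC POINT, POINTWISE** (registered helper `derivRecovery_pointwise` of
`stub_analyticPackingImplosion`): at a point with `S > 0`, `|W|, |W′|, |S′/S|, |S(S′ + S)| ≤ A`, `1 + S² ≤ K|Δ|`
(`Δ = (W−1)² − S²`), every solution `(u₁, u₂)` (values `u₁, u₂`, derivatives `u₁′, u₂′`) of the two resolvent equations
`Λu − Lu = f` satisfies `|u₁′| + (1 + S²)|(u₂′S − u₂S′)/S²| ≤ (2A + 6)K(A² + 10A + r + 3)((|Λ| + 1)(|u₁| + |u₂|/S) +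
|f₁| + |f₂|/S)`. [folklore] -/
theorem derivRecovery_pointwise : ∀ (r W W' S S' Λ u₁ u₁' u₂ u₂' f₁ f₂ A K : ℝ), 0 < S → 0 ≤ r → |W| ≤ A → |W'| ≤ A → |S' / S| ≤ A → |S * (S' + S)| ≤ A → 1 + S ^ 2 ≤ K * |(W - 1) ^ 2 - S ^ 2| → Λ * u₁ - ((W - 1) * u₁' + 3 * S * u₂' + (W' + 2 * W - r) * u₁ + (3 * S' + 6 * S) * u₂) = f₁ → Λ * u₂ - (S / 3 * u₁' + (W - 1) * u₂' + (S' + 2 * S) * u₁ + (W' / 3 + 2 * W - r) * u₂) = f₂ → |u₁'| + (1 + S ^ 2) * |(u₂' * S - u₂ * S') / S ^ 2| ≤ (2 * A + 6) * K * (A ^ 2 + 10 * A + r + 3) * ((|Λ| + 1) * (|u₁| + |u₂| / S) + (|f₁| + |f₂| / S)) := by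
  intro r W W' S S' Λ u₁ u₁' u₂ u₂' f₁ f₂ A K hS hr hW hW' hσ hπ hK h1 h2
  have hS0 : S ≠ 0 := hS.ne'
  have hA0 : 0 ≤ A := (abs_nonneg W).trans hW
  -- the relative perturbation and its derivative (opaque names with defining equations)
  obtain ⟨v, hv⟩ : ∃ v : ℝ, v = u₂ / S := ⟨_, rfl⟩
  obtain ⟨v', hv'⟩ : ∃ v' : ℝ, v' = (u₂' * S - u₂ * S') / S ^ 2 := ⟨_, rfl⟩
  have hu₂ : u₂ = S * v := by rw [hv]; field_simp
  have hu₂' : u₂' = S * v' + S' * v := by rw [hv', hv]; field_simp; ring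
  have habsv : |v| = |u₂| / S := by rw [hv, abs_div, abs_of_pos hS]
  -- the determinant
  obtain ⟨Δ, hΔ⟩ : ∃ Δ : ℝ, Δ = (W - 1) ^ 2 - S ^ 2 := ⟨_, rfl⟩
  rw [← hΔ] at hK
  have hΔpos : 0 < |Δ| := by
    by_contra hle
    push Not at hle
    have hΔabs : |Δ| = 0 := le_antisymm hle (abs_nonneg _)
    rw [hΔabs, mul_zero] at hK
    nlinarith [sq_nonneg S]
  have hΔ0 : Δ ≠ 0 := abs_pos.mp hΔpos
  have hKpos : 0 ≤ K := by
    by_contra hneg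
    push Not at hneg
    have h' : K * |Δ| < 0 := mul_neg_of_neg_of_pos hneg hΔpos
    nlinarith [sq_nonneg S]
  have hKΔ : (1 + S ^ 2) / |Δ| ≤ K := by rw [div_le_iff₀ hΔpos]; exact hK
  -- the right-hand sides
  obtain ⟨σ, hσdef⟩ : ∃ σ : ℝ, σ = S' / S := ⟨_, rfl⟩
  rw [← hσdef] at hσ
  have hS' : S' = S * σ := by rw [hσdef]; field_simp
  obtain ⟨π, hπdef⟩ : ∃ π : ℝ, π = S * (S' + S) := ⟨_, rfl⟩
  rw [← hπdef] at hπ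
  obtain ⟨R₁, hR₁⟩ : ∃ R₁ : ℝ, R₁ = Λ * u₁ - (W' + 2 * W - r) * u₁ - 6 * π * v - f₁ := ⟨_, rfl⟩
  obtain ⟨R₂, hR₂⟩ : ∃ R₂ : ℝ, R₂ = Λ * v - (σ + 2) * u₁ - (W' / 3 + 2 * W - r + (W - 1) * σ) * v - f₂ / S := ⟨_, rfl⟩
  -- the first-order system in `(u₁′, v′)`
  have e1 : (W - 1) * u₁' + 3 * S ^ 2 * v' = R₁ := by
    rw [hR₁, hπdef, ← h1, hu₂', hu₂]; ring
  have e2 : 1 / 3 * u₁' + (W - 1) * v' = R₂ := by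
    have h2' : Λ * (S * v) - (S / 3 * u₁' + (W - 1) * (S * v' + S' * v) + (S' + 2 * S) * u₁ +
        (W' / 3 + 2 * W - r) * (S * v)) = f₂ := by rw [← hu₂, ← hu₂']; exact h2
    rw [hS'] at h2'
    have hSR : S * (f₂ / S) = f₂ := by field_simp
    have hmul : S * (1 / 3 * u₁' + (W - 1) * v') = S * R₂ := by
      rw [hR₂]
      linear_combination (-1 : ℝ) * h2' + hSR
    exact mul_left_cancel₀ hS0 hmul
  -- Cramer's rule
  have cu : u₁' = ((W - 1) * R₁ - 3 * S ^ 2 * R₂) / Δ := by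
    rw [eq_div_iff hΔ0, ← e1, ← e2, hΔ]; ring
  have cv : v' = ((W - 1) * R₂ - R₁ / 3) / Δ := by
    rw [eq_div_iff hΔ0, ← e1, ← e2, hΔ]; ring
  -- sizes: `n = |u₁| + |v|`, `m = |f₁| + |f₂|/S`, `L = A² + 10A + r + 3`
  obtain ⟨L, hLdef⟩ : ∃ L : ℝ, L = A ^ 2 + 10 * A + r + 3 := ⟨_, rfl⟩
  have hL1 : 1 ≤ L := by rw [hLdef]; nlinarith
  obtain ⟨n, hndef⟩ : ∃ n : ℝ, n = |u₁| + |v| := ⟨_, rfl⟩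
  obtain ⟨m, hmdef⟩ : ∃ m : ℝ, m = |f₁| + |f₂| / S := ⟨_, rfl⟩
  have hn0 : 0 ≤ n := by rw [hndef]; positivity
  have hm0 : 0 ≤ m := by rw [hmdef]; positivity
  have hf₂S : |f₂ / S| = |f₂| / S := by rw [abs_div, abs_of_pos hS]
  have hW1 : |W - 1| ≤ A + 1 := by
    calc |W - 1| ≤ |W| + |1| := abs_sub _ _
      _ ≤ A + 1 := by rw [abs_one]; linarith
  -- |R₁| ≤ (|Λ| + L) n + m
  have hR₁b : |R₁| ≤ (|Λ| + L) * n + m := by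
    have t1 := mul_mem_bounds (le_refl |Λ|) u₁
    have t2 := mul_mem_bounds hW' u₁
    have t3 := mul_mem_bounds hW u₁
    have t4 := mul_mem_bounds hπ v
    have hru1 : r * u₁ ≤ r * |u₁| := mul_le_mul_of_nonneg_left (le_abs_self u₁) hr
    have hru2 : r * (-|u₁|) ≤ r * u₁ := mul_le_mul_of_nonneg_left (neg_abs_le u₁) hr
    have hf := abs_le.mp (le_refl |f₁|)
    have e : R₁ = Λ * u₁ - W' * u₁ - 2 * (W * u₁) + r * u₁ - 6 * (π * v) - f₁ := by rw [hR₁]; ring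
    have hnat : |R₁| ≤ (|Λ| + 3 * A + r) * |u₁| + 6 * A * |v| + |f₁| := by
      rw [abs_le, e]
      constructor
      · linarith only [t1.1, t2.2, t3.2, t4.2, hru2, hf.2]
      · linarith only [t1.2, t2.1, t3.1, t4.1, hru1, hf.1]
    have hgap : (|Λ| + 3 * A + r) * |u₁| + 6 * A * |v| + |f₁| ≤ (|Λ| + L) * n + m := by
      rw [hndef, hmdef, hLdef]
      have g1 : 0 ≤ (A ^ 2 + 7 * A + 3) * |u₁| :=
        mul_nonneg (by linarith only [hA0, sq_nonneg A]) (abs_nonneg u₁)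
      have g2 : 0 ≤ (|Λ| + A ^ 2 + 4 * A + r + 3) * |v| :=
        mul_nonneg (by linarith only [hA0, hr, sq_nonneg A, abs_nonneg Λ]) (abs_nonneg v)
      have g3 : 0 ≤ |f₂| / S := div_nonneg (abs_nonneg _) hS.le
      linarith only [g1, g2, g3]
    exact hnat.trans hgap
  -- |R₂| ≤ (|Λ| + L) n + m
  have hR₂b : |R₂| ≤ (|Λ| + L) * n + m := by
    have t1 := mul_mem_bounds (le_refl |Λ|) v
    have t2 := mul_mem_bounds hσ u₁
    have t3 := mul_mem_bounds hW' v
    have t4 := mul_mem_bounds hW v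
    have t5 := mul_mem_bounds hW1 (σ * v)
    have t5' : |σ * v| ≤ A * |v| := abs_mul_le_of_abs_le hσ v
    have hu1 : u₁ ≤ |u₁| := le_abs_self u₁
    have hu2 : -|u₁| ≤ u₁ := neg_abs_le u₁
    have hrv1 : r * v ≤ r * |v| := mul_le_mul_of_nonneg_left (le_abs_self v) hr
    have hrv2 : r * (-|v|) ≤ r * v := mul_le_mul_of_nonneg_left (neg_abs_le v) hr
    have hf := abs_le.mp (le_refl |f₂ / S|)
    rw [hf₂S] at hf
    have e : R₂ = Λ * v - σ * u₁ - 2 * u₁ - 1 / 3 * (W' * v) - 2 * (W * v) + r * v - (W - 1) * (σ * v) - f₂ / S := by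
      rw [hR₂]; ring
    have hAv : (A + 1) * |σ * v| ≤ (A + 1) * (A * |v|) := mul_le_mul_of_nonneg_left t5' (by linarith)
    have hnat : |R₂| ≤ |Λ| * |v| + (A + 2) * |u₁| + (A / 3 + 2 * A + r + (A + 1) * A) * |v| + |f₂| / S := by
      rw [abs_le, e]
      constructor
      · linarith only [t1.1, t2.2, t3.2, t4.2, t5.2, hu1, hrv2, hAv, hf.2]
      · linarith only [t1.2, t2.1, t3.1, t4.1, t5.1, hu2, hrv1, hAv, hf.1]
    have hgap : |Λ| * |v| + (A + 2) * |u₁| + (A / 3 + 2 * A + r + (A + 1) * A) * |v| + |f₂| / S ≤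
        (|Λ| + L) * n + m := by
      rw [hndef, hmdef, hLdef]
      have g1 : 0 ≤ (|Λ| + A ^ 2 + 9 * A + r + 1) * |u₁| :=
        mul_nonneg (by linarith only [hA0, hr, sq_nonneg A, abs_nonneg Λ]) (abs_nonneg u₁)
      have g2 : 0 ≤ (20 / 3 * A + 3) * |v| := mul_nonneg (by linarith only [hA0]) (abs_nonneg v)
      have g3 : 0 ≤ |f₁| := abs_nonneg _
      linarith only [g1, g2, g3]
    exact hnat.trans hgap
  -- the common bound `ℛ`
  obtain ⟨ℛ, hℛdef⟩ : ∃ ℛ : ℝ, ℛ = (|Λ| + L) * n + m := ⟨_, rfl⟩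
  rw [← hℛdef] at hR₁b hR₂b
  have hℛ0 : 0 ≤ ℛ := by rw [hℛdef]; positivity
  have hℛL : ℛ ≤ L * ((|Λ| + 1) * n + m) := by
    rw [hℛdef]
    have h1 : |Λ| * n ≤ L * (|Λ| * n) := le_mul_of_one_le_left (mul_nonneg (abs_nonneg Λ) hn0) hL1
    have h2 : m ≤ L * m := le_mul_of_one_le_left hm0 hL1
    have h3 : 0 ≤ L := by linarith only [hL1]
    linarith only [h1, h2]
  -- the derivatives through Cramer
  have hu₁'b : |u₁'| ≤ ((A + 1) + 3 * S ^ 2) * ℛ / |Δ| := by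
    rw [cu, abs_div, div_le_div_iff_of_pos_right hΔpos]
    calc |(W - 1) * R₁ - 3 * S ^ 2 * R₂| ≤ |(W - 1) * R₁| + |3 * S ^ 2 * R₂| := abs_sub _ _
      _ = |W - 1| * |R₁| + 3 * S ^ 2 * |R₂| := by
          rw [abs_mul, abs_mul, abs_of_nonneg (by positivity : (0:ℝ) ≤ 3 * S ^ 2)]
      _ ≤ (A + 1) * ℛ + 3 * S ^ 2 * ℛ := by gcongr
      _ = ((A + 1) + 3 * S ^ 2) * ℛ := by ring
  have hv'b : |v'| ≤ (A + 2) * ℛ / |Δ| := by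
    rw [cv, abs_div, div_le_div_iff_of_pos_right hΔpos]
    calc |(W - 1) * R₂ - R₁ / 3| ≤ |(W - 1) * R₂| + |R₁ / 3| := abs_sub _ _
      _ = |W - 1| * |R₂| + |R₁| / 3 := by rw [abs_mul, abs_div, abs_of_pos (by norm_num : (0:ℝ) < 3)]
      _ ≤ (A + 1) * ℛ + ℛ / 3 := by gcongr
      _ ≤ (A + 2) * ℛ := by linarith only [hℛ0]
  -- assemble
  have hmain : |u₁'| + (1 + S ^ 2) * |v'| ≤ (2 * A + 6) * ((1 + S ^ 2) / |Δ|) * ℛ := by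
    have h3 : (1 + S ^ 2) * |v'| ≤ (1 + S ^ 2) * ((A + 2) * ℛ / |Δ|) :=
      mul_le_mul_of_nonneg_left hv'b (by positivity)
    have h4 : ((A + 1) + 3 * S ^ 2) * ℛ / |Δ| ≤ (1 + S ^ 2) * (A + 4) * ℛ / |Δ| := by
      rw [div_le_div_iff_of_pos_right hΔpos]
      apply mul_le_mul_of_nonneg_right _ hℛ0
      nlinarith only [sq_nonneg S, hA0]
    have e5 : (1 + S ^ 2) * (A + 4) * ℛ / |Δ| + (1 + S ^ 2) * ((A + 2) * ℛ / |Δ|) =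
        (2 * A + 6) * ((1 + S ^ 2) / |Δ|) * ℛ := by
      field_simp
      ring
    linarith only [hu₁'b, h3, h4, e5.le, e5.ge]
  have hv'eq : |(u₂' * S - u₂ * S') / S ^ 2| = |v'| := by rw [hv']
  rw [hv'eq, ← habsv]
  have hfin : (2 * A + 6) * ((1 + S ^ 2) / |Δ|) * ℛ ≤ (2 * A + 6) * K * (L * ((|Λ| + 1) * n + m)) := by
    have h6 : (2 * A + 6) * ((1 + S ^ 2) / |Δ|) * ℛ ≤ (2 * A + 6) * K * ℛ := by
      apply mul_le_mul_of_nonneg_right _ hℛ0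
      exact mul_le_mul_of_nonneg_left hKΔ (by linarith only [hA0])
    have h7 : (2 * A + 6) * K * ℛ ≤ (2 * A + 6) * K * (L * ((|Λ| + 1) * n + m)) :=
      mul_le_mul_of_nonneg_left hℛL (mul_nonneg (by linarith only [hA0]) hKpos)
    exact h6.trans h7
  calc |u₁'| + (1 + S ^ 2) * |v'| ≤ (2 * A + 6) * ((1 + S ^ 2) / |Δ|) * ℛ := hmain
    _ ≤ (2 * A + 6) * K * (L * ((|Λ| + 1) * n + m)) := hfin
    _ = (2 * A + 6) * K * L * ((|Λ| + 1) * (|u₁| + |v|) + (|f₁| + |f₂| / S)) := by rw [hndef, hmdef]; ring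
    _ = (2 * A + 6) * K * (A ^ 2 + 10 * A + r + 3) * ((|Λ| + 1) * (|u₁| + |v|) + (|f₁| + |f₂| / S)) := by
        rw [hLdef]

end Summit.AtomisticToContinuum.HydrodynamicLimit.Theorems.PackingAnalyticImplosion

end
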